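import Summits.BirchSwinnertonDyer.BirchSwinnertonDyer.Theorems.PrintCFramBottomClassIndexLawFiveLeGenusInternalRoutingWStep
import Summits.BirchSwinnertonDyer.BirchSwinnertonDyer.Theorems.PrintCFramBottomClassIndexLawFiveLeThetaCycleLegendreAtP
import Summits.BirchSwinnertonDyer.BirchSwinnertonDyer.Theorems.PrintCFramBottomClassIndexLawFiveLeGenusInternalTwistingFieldSeven
import HarnessLib

/-!
# Crux `PrintCFram.BottomClassIndexLawFiveLe` (stmt-BirchSwinnertonDyer-20372), line `eisenstein-resource-bdp-line` (registry v26):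
# THE GENUS-INTERNAL END STATE — routing kit for the genus-internal branch, part 3: v18's B2′ slot fed by «Stub C ∨ genus-internal
# datum», and the crux BY NAME with `stub_seedOffExc` CARVED (`¬(p = 7 ∧ χ(−1) = −1 ∧ χ(7) = 1)`, parity-free) plus ONE curve-level
# genus-internal hypothesis in the binder shape of w7 g7's `GenusInternal.bsdp_twist_cm7_of_regular`
# (cell `bsd-print-cfram`, width seat `bsd-line-cfram-p1-w2` g14; THEOREMS ONLY, `--supports` 20372; BSD is not proved by any of this)

HONEST FRAMING. One composition, no new mathematics beyond parts 1–2 (`…GenusInternalRoutingClassDatum`, `…GenusInternalRoutingSupply`, `…GenusInternalRoutingWStep`).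
LEAD g13's WRAP (06:40Z) names as follow-up (1) «the genus-internal W-level END STATE»; this is it:

* §1 `bsdp_of_noAdmissibleHeegnerField_of_coverOrTwistingField` — v18's fourth hypothesis B2′ («`BSD_p(W)` for a rank-one class member with
  a unit class factor and NO admissible Heegner field») follows from part 2's member-wise disjunction «Stub C ∨ genus-internal datum» together
  with the curve-level hypothesis **(TwistingFieldSeven⁷)**: `BSD_7(W)` for every globally minimal model `W` of `cm7^{(d_K)}` of analytic rank
  one, `K` imaginary quadratic with `d_K < −4` (either parity), `7 ∤ d_K`, `7` split in `K`, a cusp-exceptional prime of `d_K`, Kronecker character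
  `ε_K` and `7 ∤ B_{5,ε_K}/5` — EXACTLY the hypotheses `(K, hK, hH, hd4, εK, hεK, χ := εK, hm7, N₀ := 1, hreg, W, hW, hr)` of w7 g7's
  `GenusInternal.bsdp_twist_cm7_of_regular` (announced 06:30Z; prints4 ∧ Kriz–Li Thm 1.20 ⟹ it). On the Stub-C side the argument is v19's
  `absurd`; on the genus-internal side `BSD_7(W₁)` for the isogenous minimal model `W₁` is transported to `W` by the tree's isogeny
  invariance `Rank1ResidualX1Isogeny.bsdp_iff_of_isIsogenous` (GZK, modularity, Cassels — all inside `ToricPublishedInputs`).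
* §2 **END STATE** `bottomClassIndexLawFiveLe_of_prints5_of_krizLi_of_cutForm_of_cuspSeed_of_excOffGI_of_twistingField_of_level_of_sha` — the
  crux `PrintCFram.BottomClassIndexLawFiveLe` BY NAME from: `stub_prints5`, `stub_krizLi`, (CutForm⁶), (CuspSeed⁶), **(SeedOffExc⁶ WITH THE
  CARVE-OUT)**, **(TwistingFieldSeven⁷)**, B1-level, B1-sha — i.e. v26's `_of` END STATE (`ThetaCycle.…_of_cutForm_of_cuspSeed_of_exc_of_level_of_sha`)
  with the `exc` slot narrowed and one curve-level slot added; a candidate `_of` for a registry v27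
  `{prints5, krizLi, printsCohenKatzCusps, seedOffExcOffGI, bsdp_of_twistingFieldSeven, bsdp_of_level, bsdp_of_sha_levelZero}` in which the
  GENUS-INTERNAL CLASSES (p = 7, e* < −4 with (e*/7) = +1, either parity — LEAD g13 §4's −83, −87, −139, −143, −52, −104) have LEFT the analytic research stub.
  When w7 g7's `bsdp_twist_cm7_of_regular` is in the tree, (TwistingFieldSeven⁷) is DISCHARGED from `stub_prints5.1 ∧ stub_krizLi` (a §3 twin
  follows in this file's successor) and v27 needs no seventh stub.

CONDITIONAL on the listed hypotheses; the research residues are NOT discharged; BSD is not proved by any of this; the crux stays OPEN.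
References: [KrizLi2019] Thm. 1.20 (pp. 7–8), Rem. 1.21, §8 (pp. 49–52); [MazurWiles1984] Thm. 2; [Cohen1975] Thm. 3.1; [Katz1977] Thm. (1)–(2);
[BurungaleKobayashiNakamuraOta2026] §1.4; [Cassels1965ArithmeticVIII]; registry `Cruxes/BottomClassIndexLawFiveLe/Lines/eisenstein_resource_bdp_line.lean`.
-/

set_option autoImplicit false
-- summit-side namespace `Summit.BirchSwinnertonDyer.BirchSwinnertonDyer.…` (single-conjunct summit, D-0017 layout)
set_option linter.dupNamespace false

noncomputable section

open scoped Classical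
open NumberField WeierstrassCurve DirichletCharacter PowerSeries Literature.NumberTheory.LFunctions
  Literature.NumberTheory.EllipticCurves Literature.NumberTheory.EllipticCurves.KrizLi2019
  Literature.NumberTheory.EllipticCurves.Rank1Residual
open Literature.NumberTheory.Congruences Literature.NumberTheory.QuadraticFields

namespace Summit.BirchSwinnertonDyer.BirchSwinnertonDyer.Theorems.PrintCFram.GenusInternalRouting

open Summit.BirchSwinnertonDyer.BirchSwinnertonDyer.Theorems
open Summit.BirchSwinnertonDyer.BirchSwinnertonDyer.Theorems.PrintCFram
open Summit.BirchSwinnertonDyer.Rank1Residual Summit.BirchSwinnertonDyer.Rank1Residual.X12.O11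

/-! ## §1 v18's B2′ from «Stub C ∨ genus-internal datum» and (TwistingFieldSeven⁷) -/

/-- **B2′ ⟸ «Stub C ∨ GENUS-INTERNAL DATUM» ∧ (TwistingFieldSeven⁷).** v18's Stub B2′ (`BSD_p(W)` for a rank-one class member with a unit
class factor all of whose admissible Heegner fields have a NON-unit field factor) from part 2's member-wise disjunction (`hCGI`) and the
curve-level genus-internal hypothesis (`hGI`, the binder shape of w7 g7's `GenusInternal.bsdp_twist_cm7_of_regular` with `χ := ε_K`):
Stub-C branch by `absurd` (as v19's `bsdp_of_noAdmissibleHeegnerField_of_cover`); genus-internal branch by `hGI` at the isogenous minimal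
model `W₁` and isogeny invariance of `BSD_p` at analytic rank `≤ 1` (`Rank1ResidualX1Isogeny.bsdp_iff_of_isIsogenous`; GZK `hGZK`,
modularity `hmod`, Cassels `hCassels`). [cite: KrizLi2019, Thm. 1.20 (pp. 7–8) and §8 (pp. 49–52)] [cite: Cassels1965ArithmeticVIII] [cite: MilneADT2006, Thm. I.7.3] -/
theorem bsdp_of_noAdmissibleHeegnerField_of_coverOrTwistingField (hGZK : rank_eq_analyticRank_of_analyticRank_le_one)
    (hmod : hasEntireLFunction_rat) (hCassels : bsdRHS_eq_of_isIsogenous)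
    (hCGI : ∀ (W : WeierstrassCurve ℚ) [W.IsElliptic] [W.IsGloballyMinimal] (p : ℕ) [Fact p.Prime], W.HasCM → CMRamified W p → 5 ≤ p →
      W.analyticRank = 1 → ∀ (f : ℕ) [NeZero f] (ψ : DirichletCharacter ℚ_[p] f) (ω : DirichletCharacter ℚ_[p] p), ψ.Odd →
      IsTeichmullerCharacter ω →
      (∀ ℓ : ℕ, ℓ.Prime → ¬ (ℓ ∣ p * W.conductorNorm ℤ) →
        ‖((W.LFunction ℓ : ℤ) : ℚ_[p]) - (ψ (ℓ : ZMod f) + ψ⁻¹ (ℓ : ZMod f) * ω (ℓ : ZMod p))‖ < 1) →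
      ¬ ‖bernoulliOnePrim ψ⁻¹‖ ≤ (p : ℝ)⁻¹ →
      (∃ (K : Type) (_ : Field K) (_ : NumberField K) (εK : DirichletCharacter ℚ_[p] (NumberField.discr K).natAbs),
        IsImaginaryQuadratic K ∧ SatisfiesHeegnerHypothesis (W.conductorNorm ℤ) K ∧ Odd (NumberField.discr K) ∧
        NumberField.discr K < -4 ∧ IsKroneckerCharacterOf K εK ∧
        ¬ ‖bernoulliOnePrim (bernoulliCharTwo ψ εK ω)‖ ≤ (p : ℝ)⁻¹) ∨
      (p = 7 ∧ ∃ (W₁ : WeierstrassCurve ℚ) (_ : W₁.IsElliptic) (_ : W₁.IsGloballyMinimal)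
        (K : Type) (_ : Field K) (_ : NumberField K) (εK : DirichletCharacter ℚ_[p] (NumberField.discr K).natAbs),
        IsIsogenous W W₁ ∧ W₁.analyticRank = 1 ∧ IsImaginaryQuadratic K ∧ SatisfiesHeegnerHypothesis (p ^ 2) K ∧
        NumberField.discr K < -4 ∧ IsKroneckerCharacterOf K εK ∧
        (NumberField.discr K).natAbs.Coprime p ∧
        (∃ ℓ : ℕ, ℓ.Prime ∧ (ℓ : ℤ) ∣ NumberField.discr K ∧ (ℓ % p = 1 ∨ ℓ % p = p - 1)) ∧
        ¬ ‖((p - 2 : ℕ) : ℚ_[p])⁻¹ * generalizedBernoulli (p - 2) εK‖ ≤ (p : ℝ)⁻¹ ∧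
        ∃ C : VariableChange ℚ, C • cm7.quadraticTwist ((NumberField.discr K : ℤ) : ℚ) = W₁))
    (hGI : ∀ (W : WeierstrassCurve ℚ) [W.IsElliptic] [W.IsGloballyMinimal] (p : ℕ) [Fact p.Prime],
      p = 7 → W.analyticRank = 1 →
      ∀ (K : Type) [Field K] [NumberField K] (εK : DirichletCharacter ℚ_[p] (NumberField.discr K).natAbs),
        IsImaginaryQuadratic K → SatisfiesHeegnerHypothesis (p ^ 2) K → NumberField.discr K < -4 →
        IsKroneckerCharacterOf K εK → (NumberField.discr K).natAbs.Coprime p →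
        (∃ ℓ : ℕ, ℓ.Prime ∧ (ℓ : ℤ) ∣ NumberField.discr K ∧ (ℓ % p = 1 ∨ ℓ % p = p - 1)) →
        ¬ ‖((p - 2 : ℕ) : ℚ_[p])⁻¹ * generalizedBernoulli (p - 2) εK‖ ≤ (p : ℝ)⁻¹ →
        (∃ C : VariableChange ℚ, C • cm7.quadraticTwist ((NumberField.discr K : ℤ) : ℚ) = W) → BSDp W p) :
    ∀ (W : WeierstrassCurve ℚ) [W.IsElliptic] [W.IsGloballyMinimal] (p : ℕ) [Fact p.Prime], W.HasCM → CMRamified W p → 5 ≤ p →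
      W.analyticRank = 1 → ∀ (f : ℕ) [NeZero f] (ψ : DirichletCharacter ℚ_[p] f) (ω : DirichletCharacter ℚ_[p] p), ψ.Odd →
      IsTeichmullerCharacter ω →
      (∀ ℓ : ℕ, ℓ.Prime → ¬ (ℓ ∣ p * W.conductorNorm ℤ) →
        ‖((W.LFunction ℓ : ℤ) : ℚ_[p]) - (ψ (ℓ : ZMod f) + ψ⁻¹ (ℓ : ZMod f) * ω (ℓ : ZMod p))‖ < 1) →
      ¬ ‖bernoulliOnePrim ψ⁻¹‖ ≤ (p : ℝ)⁻¹ →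
      (∀ (K : Type) [Field K] [NumberField K], IsImaginaryQuadratic K → SatisfiesHeegnerHypothesis (W.conductorNorm ℤ) K →
        Odd (NumberField.discr K) → NumberField.discr K < -4 →
        ∀ εK : DirichletCharacter ℚ_[p] (NumberField.discr K).natAbs, IsKroneckerCharacterOf K εK →
          ‖bernoulliOnePrim (bernoulliCharTwo ψ εK ω)‖ ≤ (p : ℝ)⁻¹) →
      BSDp W p := by
  intro W _ _ p _ hCM hram h5 hr f _ ψ ω hodd hω hss hcls hall
  rcases hCGI W p hCM hram h5 hr f ψ ω hodd hω hss hcls with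
      ⟨K, iK, iK', εK, hK, hH, hoddK, hd4, hεK, hfld⟩ |
      ⟨hp7, W₁, iE, iM, K, iF, iN, εK, hiso, hr₁, hK, hH, hd4, hεK, hcop, hE, hreg, hW₁⟩
  · exact absurd (@hall K iK iK' hK hH hoddK hd4 εK hεK) hfld
  · have hB₁ : BSDp W₁ p := @hGI W₁ iE iM p _ hp7 hr₁ K iF iN εK hK hH hd4 hεK hcop hE hreg hW₁
    exact (@Rank1ResidualX1Isogeny.bsdp_iff_of_isIsogenous hGZK hmod hCassels W W₁ _ iE _ iM hiso p _ hr.le).2 hB₁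

/-! ## §2 END STATE: the crux BY NAME with the seed stub carved and the genus-internal slot added -/

/-- **END STATE (candidate `_of` for a registry v27: v26 with `stub_seedOffExc` CARVED and ONE curve-level genus-internal slot).** The crux
`PrintCFram.BottomClassIndexLawFiveLe` BY NAME from: `hprints5` (= `stub_prints5`), `hKL` (= `stub_krizLi`), `hcut` (= (CutForm⁶), fed in `_of` by
`CutFormAssembly.cutForm_six_of_facts` from `stub_printsCohenKatzCusps`), `hCusp` (= (CuspSeed⁶), fed by `CuspSeed.cuspSeed_six_of_cutForm ∘
CuspGlue.cuspCutForm_six_of_facts`), **`hExcGI`** (= `stub_seedOffExc` WITH THE CARVE-OUT `¬(p = 7 ∧ χ(−1) = −1 ∧ χ(7) = 1)` inserted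
after the cusp-exceptional hypothesis — the would-be `stub_seedOffExcOffGI`), **`hGI`** (= (TwistingFieldSeven⁷), the would-be
`stub_bsdp_of_twistingFieldSeven`; discharged by w7 g7's `bsdp_twist_cm7_of_regular` from prints4 ∧ Kriz–Li once landed), `hLevel` (= `stub_bsdp_of_level`),
`hSha` (= B1-sha, fed by `SelmerCount.stubB1Sha_of_stubB1Level_of_levelZero hGZK …`). Proof: v18's END STATE
(`EisensteinEndStateV18.…_of_noAdmissibleField`) with B1 from `EisensteinEndStateV19Binders.stubB1_of_stubB1Level_of_stubB1Sha` and B2′ from §1 ∘ part 2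
(`stubC_or_twistingField_of_atP_of_cuspSeed_of_excOffGI` with (AtP⁶) := `ThetaCycle.atP_six_of_cutForm hcut`). CONDITIONAL on the eight
hypotheses; BSD is not proved by any of this. [cite: KrizLi2019, Thm. 1.20 (pp. 7–8)] [cite: MazurWiles1984, Thm. 2 (p. 216)] [cite: Cohen1975, Thm. 3.1]
[cite: Katz1977, Thm. (1)–(2)] [cite: BurungaleKobayashiNakamuraOta2026, §1.4] -/
theorem bottomClassIndexLawFiveLe_of_prints5_of_krizLi_of_cutForm_of_cuspSeed_of_excOffGI_of_twistingField_of_level_of_sha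
    (hprints5 :
      (Hsieh2014.thmA_exists_isHsiehLFunction_unrPeriod_anyLevel ∧
        LiuZhangZhang2018.thm151_thm153_modularCurve_heegnerVector_additive ∧
        Summit.BirchSwinnertonDyer.BirchSwinnertonDyer.Theses.UniversalToricDescent.ToricPublishedInputs ∧
        bsdTriple_of_hasCM_of_L_one_ne_zero) ∧
      Literature.NumberTheory.NumberFields.MazurWiles1984.thm2_card_oddChiClassGroup_eq_bernoulli)
    (hKL : thm120_padicLogHeegner_unit_of_bernoulli)
    (hcut : ∀ (p : ℕ) [Fact p.Prime] (m : ℕ) [NeZero m] (χ : DirichletCharacter ℚ_[p] m) (k : ℕ),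
      (p = 7 ∨ p = 11 ∨ p = 19 ∨ p = 43 ∨ p = 67 ∨ p = 163) →
      m.Coprime p → χ.IsPrimitive → χ.IsQuadratic → (k = (p + 1) / 4 ∨ k = (3 * p - 1) / 4) →
      2 ≤ k → k ≤ p - 2 → χ (-1) * (-1) ^ k = -1 →
      ∀ (r e : ℕ), r.Prime → r ≠ 2 → r ≠ p → e ≤ 1 →
      ∃ (𝔽 : Type) (_ : Field 𝔽) (_ : CharP 𝔽 p) (ι : ℤ_[p] →+* 𝔽)
        (M : ℕ → Submodule 𝔽 (PowerSeries 𝔽)) (w : PowerSeries 𝔽 → ℕ) (Θ : PowerSeries 𝔽 →ₗ[𝔽] PowerSeries 𝔽)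
        (G T : PowerSeries 𝔽),
        (∀ (g : PowerSeries 𝔽) (n : ℕ), coeff n (Θ g) = (n : 𝔽) * coeff n g) ∧
        (∀ (g : PowerSeries 𝔽) (j : ℕ), g ∈ M j → g ≠ 0 → w g ≤ j ∧ (p - 1) ∣ (j - w g)) ∧
        (∀ (g : PowerSeries 𝔽) (j : ℕ), g ∈ M j → g ≠ 0 → g ∈ M (w g)) ∧
        (∀ g ∈ M 0, g = C (constantCoeff g)) ∧
        (∀ (g : PowerSeries 𝔽) (j : ℕ), g ∈ M j → Θ g ∈ M (j + p + 1)) ∧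
        (∀ (g : PowerSeries 𝔽) (j : ℕ), g ∈ M j → g ≠ 0 → ¬ p ∣ w g → Θ g ≠ 0 ∧ w (Θ g) = w g + p + 1) ∧
        G * T ∈ M (k + (p + 1) / 2) ∧ T ≠ 0 ∧ (∀ j : ℕ, coeff j T ≠ 0 → p ∣ j) ∧
        (∀ a : ℕ, coeff a G ≠ 0 →
          m ∣ a ∧ a / m % 4 = 3 ∧ (∀ q : ℕ, q.Prime → q ∣ m → q ≠ 2 → jacobiSym (-((a / m : ℕ) : ℤ)) q = 1) ∧
            (2 ∣ m → a / m % 8 = 7) ∧ r ^ e ∣ a / m ∧ ¬ r ^ (e + 1) ∣ a / m) ∧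
        (∀ (n₀ f : ℕ) (K : Type) [Field K] [NumberField K] (εK : DirichletCharacter ℚ_[p] (NumberField.discr K).natAbs),
          Squarefree n₀ → n₀ % 4 = 3 → 0 < f →
          (m ∣ m * (n₀ * f ^ 2) ∧ m * (n₀ * f ^ 2) / m % 4 = 3 ∧
            (∀ q : ℕ, q.Prime → q ∣ m → q ≠ 2 → jacobiSym (-((m * (n₀ * f ^ 2) / m : ℕ) : ℤ)) q = 1) ∧
            (2 ∣ m → m * (n₀ * f ^ 2) / m % 8 = 7) ∧ r ^ e ∣ m * (n₀ * f ^ 2) / m ∧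
            ¬ r ^ (e + 1) ∣ m * (n₀ * f ^ 2) / m) →
          IsImaginaryQuadratic K → NumberField.discr K = -(n₀ : ℤ) → IsKroneckerCharacterOf K εK →
          ∃ (t : ℤ) (x : ℤ_[p]), (f = 1 → t = 1) ∧
            (x : ℚ_[p]) = (k : ℚ_[p])⁻¹ * @generalizedBernoulli ℚ_[p] _ _
              (changeLevel (dvd_mul_right m (NumberField.discr K).natAbs) χ *
                changeLevel (dvd_mul_left (NumberField.discr K).natAbs m) εK).conductor ⟨conductor_ne_zero _⟩ k
              (changeLevel (dvd_mul_right m (NumberField.discr K).natAbs) χ *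
                changeLevel (dvd_mul_left (NumberField.discr K).natAbs m) εK).primitiveCharacter ∧
            coeff (m * (n₀ * f ^ 2)) G = (t : 𝔽) * ι x))
    (hCusp : ∀ (p : ℕ) [Fact p.Prime] (m : ℕ) [NeZero m] (χ : DirichletCharacter ℚ_[p] m) (k : ℕ),
      (p = 7 ∨ p = 11 ∨ p = 19 ∨ p = 43 ∨ p = 67 ∨ p = 163) →
      m.Coprime p → χ.IsPrimitive → χ.IsQuadratic → (k = (p + 1) / 4 ∨ k = (3 * p - 1) / 4) →
      2 ≤ k → k ≤ p - 2 → χ (-1) * (-1) ^ k = -1 →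
      ¬ (∃ ℓ : ℕ, ℓ.Prime ∧ ℓ ∣ m ∧ (ℓ % p = 1 ∨ ℓ % p = p - 1)) →
      ∃ (K₀ : Type) (_ : Field K₀) (_ : NumberField K₀) (ε₀ : DirichletCharacter ℚ_[p] (NumberField.discr K₀).natAbs),
        IsImaginaryQuadratic K₀ ∧
        (∀ q : ℕ, q.Prime → q ∣ m → ((Ideal.span {(q : ℤ)}).primesOver (𝓞 K₀)).ncard = 2) ∧
        Odd (NumberField.discr K₀) ∧ NumberField.discr K₀ < -4 ∧ IsKroneckerCharacterOf K₀ ε₀ ∧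
        ¬ ‖(k : ℚ_[p])⁻¹ * @generalizedBernoulli ℚ_[p] _ _
            (changeLevel (dvd_mul_right m (NumberField.discr K₀).natAbs) χ *
              changeLevel (dvd_mul_left (NumberField.discr K₀).natAbs m) ε₀).conductor ⟨conductor_ne_zero _⟩ k
            (changeLevel (dvd_mul_right m (NumberField.discr K₀).natAbs) χ *
              changeLevel (dvd_mul_left (NumberField.discr K₀).natAbs m) ε₀).primitiveCharacter‖ ≤ (p : ℝ)⁻¹)
    (hExcGI : ∀ (p : ℕ) [Fact p.Prime] (m : ℕ) [NeZero m] (χ : DirichletCharacter ℚ_[p] m) (k : ℕ),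
      (p = 7 ∨ p = 11 ∨ p = 19 ∨ p = 43 ∨ p = 67 ∨ p = 163) →
      m.Coprime p → χ.IsPrimitive → χ.IsQuadratic → (k = (p + 1) / 4 ∨ k = (3 * p - 1) / 4) →
      2 ≤ k → k ≤ p - 2 → χ (-1) * (-1) ^ k = -1 →
      ¬ ((∀ q : ℕ, q.Prime → q ∣ m → q ≠ 2 → jacobiSym (-(p : ℤ)) q = 1) ∧ (2 ∣ m → p % 8 = 7)) →
      (∃ ℓ : ℕ, ℓ.Prime ∧ ℓ ∣ m ∧ (ℓ % p = 1 ∨ ℓ % p = p - 1)) →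
      ¬ (p = 7 ∧ χ (-1) = -1 ∧ χ (7 : ZMod m) = 1) →
      ¬ ‖((p - k : ℕ) : ℚ_[p])⁻¹ * generalizedBernoulli (p - k) χ‖ ≤ (p : ℝ)⁻¹ →
      ∃ (K₀ : Type) (_ : Field K₀) (_ : NumberField K₀) (ε₀ : DirichletCharacter ℚ_[p] (NumberField.discr K₀).natAbs),
        IsImaginaryQuadratic K₀ ∧
        (∀ q : ℕ, q.Prime → q ∣ m → ((Ideal.span {(q : ℤ)}).primesOver (𝓞 K₀)).ncard = 2) ∧
        Odd (NumberField.discr K₀) ∧ NumberField.discr K₀ < -4 ∧ IsKroneckerCharacterOf K₀ ε₀ ∧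
        ¬ ‖(k : ℚ_[p])⁻¹ * @generalizedBernoulli ℚ_[p] _ _
            (changeLevel (dvd_mul_right m (NumberField.discr K₀).natAbs) χ *
              changeLevel (dvd_mul_left (NumberField.discr K₀).natAbs m) ε₀).conductor ⟨conductor_ne_zero _⟩ k
            (changeLevel (dvd_mul_right m (NumberField.discr K₀).natAbs) χ *
              changeLevel (dvd_mul_left (NumberField.discr K₀).natAbs m) ε₀).primitiveCharacter‖ ≤ (p : ℝ)⁻¹)
    (hGI : ∀ (W : WeierstrassCurve ℚ) [W.IsElliptic] [W.IsGloballyMinimal] (p : ℕ) [Fact p.Prime],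
      p = 7 → W.analyticRank = 1 →
      ∀ (K : Type) [Field K] [NumberField K] (εK : DirichletCharacter ℚ_[p] (NumberField.discr K).natAbs),
        IsImaginaryQuadratic K → SatisfiesHeegnerHypothesis (p ^ 2) K → NumberField.discr K < -4 →
        IsKroneckerCharacterOf K εK → (NumberField.discr K).natAbs.Coprime p →
        (∃ ℓ : ℕ, ℓ.Prime ∧ (ℓ : ℤ) ∣ NumberField.discr K ∧ (ℓ % p = 1 ∨ ℓ % p = p - 1)) →
        ¬ ‖((p - 2 : ℕ) : ℚ_[p])⁻¹ * generalizedBernoulli (p - 2) εK‖ ≤ (p : ℝ)⁻¹ →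
        (∃ C : VariableChange ℚ, C • cm7.quadraticTwist ((NumberField.discr K : ℤ) : ℚ) = W) → BSDp W p)
    (hLevel :
      ∀ (W : WeierstrassCurve ℚ) [W.IsElliptic] [W.IsGloballyMinimal] (p : ℕ) [Fact p.Prime],
        W.HasCM → CMRamified W p → 5 ≤ p → W.analyticRank = 1 →
        ∀ P : W.toAffine.Point, ¬ IsOfFinAddOrder P →
          (∀ R : W.toAffine.Point, ∃ (k : ℤ) (T : W.toAffine.Point), IsOfFinAddOrder T ∧ R = k • P + T) →
          (∃ Q : (W.baseChange ℚ_[p]).toAffine.Point, p • Q = W.toPadicPoint p P) →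
          BSDp W p)
    (hSha :
      ∀ (W : WeierstrassCurve ℚ) [W.IsElliptic] [W.IsGloballyMinimal] (p : ℕ) [Fact p.Prime],
        W.HasCM → CMRamified W p → 5 ≤ p → W.analyticRank = 1 →
        (∃ s ∈ W.sha, s ≠ 0 ∧ p • s = 0) → BSDp W p) :
    Summit.BirchSwinnertonDyer.BirchSwinnertonDyer.Theses.PrintCFram.BottomClassIndexLawFiveLe := by
  obtain ⟨-, -, ⟨-, -, hGZK, -⟩, -, -, hmod, hCassels⟩ := Theorems.PrintCFram.InputsPrints.prints7_of_prints4 hprints5.1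
  exact EisensteinEndStateV18.bottomClassIndexLawFiveLe_of_prints4_of_krizLi_of_classFactor_of_noAdmissibleField hprints5.1 hKL
    (EisensteinEndStateV19Binders.stubB1_of_stubB1Level_of_stubB1Sha hprints5.2 hGZK hCassels hmod hLevel hSha)
    (bsdp_of_noAdmissibleHeegnerField_of_coverOrTwistingField hGZK hmod hCassels
      (stubC_or_twistingField_of_atP_of_cuspSeed_of_excOffGI (ThetaCycle.atP_six_of_cutForm hcut) hCusp hExcGI) hGI)

/-! ## §3 (TwistingFieldSeven⁷) DISCHARGED from the four print facts and Kriz–Li Thm 1.20 (w7 g7's p703735) -/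

/-- **(TwistingFieldSeven⁷) ⟸ prints4 ∧ Kriz–Li Thm. 1.20** — w7 g7's `GenusInternal.bsdp_twist_cm7_of_regular_kronecker` (p703735: `BSD₇` of
every globally minimal model of `X₀(49)^{(d_K)}` of analytic rank one over a `7`-regular imaginary quadratic Heegner field `K` of `X₀(49)` with
`d_K < −4`, from Hsieh 2014 Thm. A ∧ Liu–Zhang–Zhang 2018 ∧ `ToricPublishedInputs` ∧ Burungale–Flach 2024 Cor. 2 and Kriz–Li 2019 Thm. 1.20 via
w6 g8's block at `(cm7, 7, ω²)` and w7 g7's stripped-datum display) read in the socket's currency (`p = 7` bound, `SatisfiesHeegnerHypothesis (p^2)`,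
regularity spelled `((p − 2 : ℕ) : ℚ_[p])⁻¹ * generalizedBernoulli (p − 2) ε_K`; the parity, coprimality and cusp-exceptional clauses of the socket
are not needed by the provider and are dropped). So the genus-internal slot of §2 costs NO new stub. BSD is not proved by any of this.
[cite: KrizLi2019, Thm. 1.20 (pp. 7–8) and Rem. 1.21 (p. 8)] [cite: BurungaleFlach2024, Cor. 2] [cite: GrossZagier1986, Thm. I.(6.3) and (7.3)] -/
theorem twistingFieldSeven_of_prints_of_krizLi
    (hprints : Hsieh2014.thmA_exists_isHsiehLFunction_unrPeriod_anyLevel ∧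
      LiuZhangZhang2018.thm151_thm153_modularCurve_heegnerVector_additive ∧
      Summit.BirchSwinnertonDyer.BirchSwinnertonDyer.Theses.UniversalToricDescent.ToricPublishedInputs ∧
      bsdTriple_of_hasCM_of_L_one_ne_zero)
    (hKL : thm120_padicLogHeegner_unit_of_bernoulli) :
    ∀ (W : WeierstrassCurve ℚ) [W.IsElliptic] [W.IsGloballyMinimal] (p : ℕ) [Fact p.Prime],
      p = 7 → W.analyticRank = 1 →
      ∀ (K : Type) [Field K] [NumberField K] (εK : DirichletCharacter ℚ_[p] (NumberField.discr K).natAbs),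
        IsImaginaryQuadratic K → SatisfiesHeegnerHypothesis (p ^ 2) K → NumberField.discr K < -4 →
        IsKroneckerCharacterOf K εK → (NumberField.discr K).natAbs.Coprime p →
        (∃ ℓ : ℕ, ℓ.Prime ∧ (ℓ : ℤ) ∣ NumberField.discr K ∧ (ℓ % p = 1 ∨ ℓ % p = p - 1)) →
        ¬ ‖((p - 2 : ℕ) : ℚ_[p])⁻¹ * generalizedBernoulli (p - 2) εK‖ ≤ (p : ℝ)⁻¹ →
        (∃ C : VariableChange ℚ, C • cm7.quadraticTwist ((NumberField.discr K : ℤ) : ℚ) = W) → BSDp W p := by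
  intro W _ _ p _ hp7 hr K _ _ εK hK hH hd4 hεK _hcop _hE hreg hW
  subst hp7
  have hH49 : SatisfiesHeegnerHypothesis 49 K := by simpa using hH
  have hreg' : ¬ ‖(5 : ℚ_[7])⁻¹ * generalizedBernoulli 5 εK‖ ≤ (7 : ℝ)⁻¹ := by simpa using hreg
  exact GenusInternal.bsdp_twist_cm7_of_regular_kronecker hprints hKL K hK hH49 hd4 εK hεK hreg' W hW hr

/-! ## §4 END STATE for a registry v27 = v26 with ONE substitution: `stub_seedOffExc` ↦ its CARVED form (no new stub) -/

/-- **END STATE (candidate `_of` for registry v27 = v26 with `stub_seedOffExc` replaced by `stub_seedOffExcOffGI`, SIX stubs, NO new one).** The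
crux `PrintCFram.BottomClassIndexLawFiveLe` BY NAME from `hprints5` (= `stub_prints5`), `hKL` (= `stub_krizLi`), `hcut` (= (CutForm⁶)), `hCusp`
(= (CuspSeed⁶)) — both fed in `_of` from the cite-only `stub_printsCohenKatzCusps` exactly as in v26 —, **`hExcGI`** = `stub_seedOffExc` WITH THE
CARVE-OUT `¬(p = 7 ∧ χ(−1) = −1 ∧ χ(7) = 1)` inserted after its cusp-exceptional hypothesis (a WEAKER statement: the genus-internal
classes — `p = 7`, `e* < −4` of either parity with `(e*/7) = +1`, e.g. `e* ∈ {−83, −87, −139, −143, −52, −104}` of LEAD g13 §4 — are no longer asked for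
a split seed),
`hLevel` (= `stub_bsdp_of_level`), `hSha` (= B1-sha). §2 with its genus-internal slot discharged by §3. The v27 `_of` is v26's with `ThetaCycle.…`
replaced by this theorem and `stub_seedOffExc` by `stub_seedOffExcOffGI`:
`fun hGZK => GenusInternalRouting.bottomClassIndexLawFiveLe_of_prints5_of_krizLi_of_cutForm_of_cuspSeed_of_excOffGI_of_level_of_sha stub_prints5 stub_krizLi
(CutFormAssembly.cutForm_six_of_facts stub_printsCohenKatzCusps.1 stub_printsCohenKatzCusps.2.1) (CuspSeed.cuspSeed_six_of_cutForm
(CuspGlue.cuspCutForm_six_of_facts stub_printsCohenKatzCusps.1 stub_printsCohenKatzCusps.2.2)) stub_seedOffExcOffGI stub_bsdp_of_level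
(SelmerCount.stubB1Sha_of_stubB1Level_of_levelZero hGZK stub_bsdp_of_level stub_bsdp_of_sha_levelZero) hGZK`. CONDITIONAL on the seven hypotheses;
the research residues are NOT discharged; BSD is not proved by any of this; the crux stays OPEN. [cite: KrizLi2019, Thm. 1.20 (pp. 7–8)]
[cite: MazurWiles1984, Thm. 2 (p. 216)] [cite: Cohen1975, Thm. 3.1] [cite: Katz1977, Thm. (1)–(2)] [cite: BurungaleKobayashiNakamuraOta2026, §1.4] -/
theorem bottomClassIndexLawFiveLe_of_prints5_of_krizLi_of_cutForm_of_cuspSeed_of_excOffGI_of_level_of_sha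
    (hprints5 :
      (Hsieh2014.thmA_exists_isHsiehLFunction_unrPeriod_anyLevel ∧
        LiuZhangZhang2018.thm151_thm153_modularCurve_heegnerVector_additive ∧
        Summit.BirchSwinnertonDyer.BirchSwinnertonDyer.Theses.UniversalToricDescent.ToricPublishedInputs ∧
        bsdTriple_of_hasCM_of_L_one_ne_zero) ∧
      Literature.NumberTheory.NumberFields.MazurWiles1984.thm2_card_oddChiClassGroup_eq_bernoulli)
    (hKL : thm120_padicLogHeegner_unit_of_bernoulli)
    (hcut : ∀ (p : ℕ) [Fact p.Prime] (m : ℕ) [NeZero m] (χ : DirichletCharacter ℚ_[p] m) (k : ℕ),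
      (p = 7 ∨ p = 11 ∨ p = 19 ∨ p = 43 ∨ p = 67 ∨ p = 163) →
      m.Coprime p → χ.IsPrimitive → χ.IsQuadratic → (k = (p + 1) / 4 ∨ k = (3 * p - 1) / 4) →
      2 ≤ k → k ≤ p - 2 → χ (-1) * (-1) ^ k = -1 →
      ∀ (r e : ℕ), r.Prime → r ≠ 2 → r ≠ p → e ≤ 1 →
      ∃ (𝔽 : Type) (_ : Field 𝔽) (_ : CharP 𝔽 p) (ι : ℤ_[p] →+* 𝔽)
        (M : ℕ → Submodule 𝔽 (PowerSeries 𝔽)) (w : PowerSeries 𝔽 → ℕ) (Θ : PowerSeries 𝔽 →ₗ[𝔽] PowerSeries 𝔽)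
        (G T : PowerSeries 𝔽),
        (∀ (g : PowerSeries 𝔽) (n : ℕ), coeff n (Θ g) = (n : 𝔽) * coeff n g) ∧
        (∀ (g : PowerSeries 𝔽) (j : ℕ), g ∈ M j → g ≠ 0 → w g ≤ j ∧ (p - 1) ∣ (j - w g)) ∧
        (∀ (g : PowerSeries 𝔽) (j : ℕ), g ∈ M j → g ≠ 0 → g ∈ M (w g)) ∧
        (∀ g ∈ M 0, g = C (constantCoeff g)) ∧
        (∀ (g : PowerSeries 𝔽) (j : ℕ), g ∈ M j → Θ g ∈ M (j + p + 1)) ∧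
        (∀ (g : PowerSeries 𝔽) (j : ℕ), g ∈ M j → g ≠ 0 → ¬ p ∣ w g → Θ g ≠ 0 ∧ w (Θ g) = w g + p + 1) ∧
        G * T ∈ M (k + (p + 1) / 2) ∧ T ≠ 0 ∧ (∀ j : ℕ, coeff j T ≠ 0 → p ∣ j) ∧
        (∀ a : ℕ, coeff a G ≠ 0 →
          m ∣ a ∧ a / m % 4 = 3 ∧ (∀ q : ℕ, q.Prime → q ∣ m → q ≠ 2 → jacobiSym (-((a / m : ℕ) : ℤ)) q = 1) ∧
            (2 ∣ m → a / m % 8 = 7) ∧ r ^ e ∣ a / m ∧ ¬ r ^ (e + 1) ∣ a / m) ∧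
        (∀ (n₀ f : ℕ) (K : Type) [Field K] [NumberField K] (εK : DirichletCharacter ℚ_[p] (NumberField.discr K).natAbs),
          Squarefree n₀ → n₀ % 4 = 3 → 0 < f →
          (m ∣ m * (n₀ * f ^ 2) ∧ m * (n₀ * f ^ 2) / m % 4 = 3 ∧
            (∀ q : ℕ, q.Prime → q ∣ m → q ≠ 2 → jacobiSym (-((m * (n₀ * f ^ 2) / m : ℕ) : ℤ)) q = 1) ∧
            (2 ∣ m → m * (n₀ * f ^ 2) / m % 8 = 7) ∧ r ^ e ∣ m * (n₀ * f ^ 2) / m ∧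
            ¬ r ^ (e + 1) ∣ m * (n₀ * f ^ 2) / m) →
          IsImaginaryQuadratic K → NumberField.discr K = -(n₀ : ℤ) → IsKroneckerCharacterOf K εK →
          ∃ (t : ℤ) (x : ℤ_[p]), (f = 1 → t = 1) ∧
            (x : ℚ_[p]) = (k : ℚ_[p])⁻¹ * @generalizedBernoulli ℚ_[p] _ _
              (changeLevel (dvd_mul_right m (NumberField.discr K).natAbs) χ *
                changeLevel (dvd_mul_left (NumberField.discr K).natAbs m) εK).conductor ⟨conductor_ne_zero _⟩ k
              (changeLevel (dvd_mul_right m (NumberField.discr K).natAbs) χ *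
                changeLevel (dvd_mul_left (NumberField.discr K).natAbs m) εK).primitiveCharacter ∧
            coeff (m * (n₀ * f ^ 2)) G = (t : 𝔽) * ι x))
    (hCusp : ∀ (p : ℕ) [Fact p.Prime] (m : ℕ) [NeZero m] (χ : DirichletCharacter ℚ_[p] m) (k : ℕ),
      (p = 7 ∨ p = 11 ∨ p = 19 ∨ p = 43 ∨ p = 67 ∨ p = 163) →
      m.Coprime p → χ.IsPrimitive → χ.IsQuadratic → (k = (p + 1) / 4 ∨ k = (3 * p - 1) / 4) →
      2 ≤ k → k ≤ p - 2 → χ (-1) * (-1) ^ k = -1 →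
      ¬ (∃ ℓ : ℕ, ℓ.Prime ∧ ℓ ∣ m ∧ (ℓ % p = 1 ∨ ℓ % p = p - 1)) →
      ∃ (K₀ : Type) (_ : Field K₀) (_ : NumberField K₀) (ε₀ : DirichletCharacter ℚ_[p] (NumberField.discr K₀).natAbs),
        IsImaginaryQuadratic K₀ ∧
        (∀ q : ℕ, q.Prime → q ∣ m → ((Ideal.span {(q : ℤ)}).primesOver (𝓞 K₀)).ncard = 2) ∧
        Odd (NumberField.discr K₀) ∧ NumberField.discr K₀ < -4 ∧ IsKroneckerCharacterOf K₀ ε₀ ∧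
        ¬ ‖(k : ℚ_[p])⁻¹ * @generalizedBernoulli ℚ_[p] _ _
            (changeLevel (dvd_mul_right m (NumberField.discr K₀).natAbs) χ *
              changeLevel (dvd_mul_left (NumberField.discr K₀).natAbs m) ε₀).conductor ⟨conductor_ne_zero _⟩ k
            (changeLevel (dvd_mul_right m (NumberField.discr K₀).natAbs) χ *
              changeLevel (dvd_mul_left (NumberField.discr K₀).natAbs m) ε₀).primitiveCharacter‖ ≤ (p : ℝ)⁻¹)
    (hExcGI : ∀ (p : ℕ) [Fact p.Prime] (m : ℕ) [NeZero m] (χ : DirichletCharacter ℚ_[p] m) (k : ℕ),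
      (p = 7 ∨ p = 11 ∨ p = 19 ∨ p = 43 ∨ p = 67 ∨ p = 163) →
      m.Coprime p → χ.IsPrimitive → χ.IsQuadratic → (k = (p + 1) / 4 ∨ k = (3 * p - 1) / 4) →
      2 ≤ k → k ≤ p - 2 → χ (-1) * (-1) ^ k = -1 →
      ¬ ((∀ q : ℕ, q.Prime → q ∣ m → q ≠ 2 → jacobiSym (-(p : ℤ)) q = 1) ∧ (2 ∣ m → p % 8 = 7)) →
      (∃ ℓ : ℕ, ℓ.Prime ∧ ℓ ∣ m ∧ (ℓ % p = 1 ∨ ℓ % p = p - 1)) →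
      ¬ (p = 7 ∧ χ (-1) = -1 ∧ χ (7 : ZMod m) = 1) →
      ¬ ‖((p - k : ℕ) : ℚ_[p])⁻¹ * generalizedBernoulli (p - k) χ‖ ≤ (p : ℝ)⁻¹ →
      ∃ (K₀ : Type) (_ : Field K₀) (_ : NumberField K₀) (ε₀ : DirichletCharacter ℚ_[p] (NumberField.discr K₀).natAbs),
        IsImaginaryQuadratic K₀ ∧
        (∀ q : ℕ, q.Prime → q ∣ m → ((Ideal.span {(q : ℤ)}).primesOver (𝓞 K₀)).ncard = 2) ∧
        Odd (NumberField.discr K₀) ∧ NumberField.discr K₀ < -4 ∧ IsKroneckerCharacterOf K₀ ε₀ ∧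
        ¬ ‖(k : ℚ_[p])⁻¹ * @generalizedBernoulli ℚ_[p] _ _
            (changeLevel (dvd_mul_right m (NumberField.discr K₀).natAbs) χ *
              changeLevel (dvd_mul_left (NumberField.discr K₀).natAbs m) ε₀).conductor ⟨conductor_ne_zero _⟩ k
            (changeLevel (dvd_mul_right m (NumberField.discr K₀).natAbs) χ *
              changeLevel (dvd_mul_left (NumberField.discr K₀).natAbs m) ε₀).primitiveCharacter‖ ≤ (p : ℝ)⁻¹)
    (hLevel :
      ∀ (W : WeierstrassCurve ℚ) [W.IsElliptic] [W.IsGloballyMinimal] (p : ℕ) [Fact p.Prime],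
        W.HasCM → CMRamified W p → 5 ≤ p → W.analyticRank = 1 →
        ∀ P : W.toAffine.Point, ¬ IsOfFinAddOrder P →
          (∀ R : W.toAffine.Point, ∃ (k : ℤ) (T : W.toAffine.Point), IsOfFinAddOrder T ∧ R = k • P + T) →
          (∃ Q : (W.baseChange ℚ_[p]).toAffine.Point, p • Q = W.toPadicPoint p P) →
          BSDp W p)
    (hSha :
      ∀ (W : WeierstrassCurve ℚ) [W.IsElliptic] [W.IsGloballyMinimal] (p : ℕ) [Fact p.Prime],
        W.HasCM → CMRamified W p → 5 ≤ p → W.analyticRank = 1 →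
        (∃ s ∈ W.sha, s ≠ 0 ∧ p • s = 0) → BSDp W p) :
    Summit.BirchSwinnertonDyer.BirchSwinnertonDyer.Theses.PrintCFram.BottomClassIndexLawFiveLe :=
  bottomClassIndexLawFiveLe_of_prints5_of_krizLi_of_cutForm_of_cuspSeed_of_excOffGI_of_twistingField_of_level_of_sha hprints5 hKL hcut
    hCusp hExcGI (twistingFieldSeven_of_prints_of_krizLi hprints5.1 hKL) hLevel hSha

end Summit.BirchSwinnertonDyer.BirchSwinnertonDyer.Theorems.PrintCFram.GenusInternalRouting

end
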